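import Summits.PneNP.PneNP.Theorems.SymmetryBudgetWindowCanoniserLevelsMain

/-!
# Window canoniser, VIII: the DAG, its outputs and the canonical form it computes (definitions)

Route `PneNP/SymmetryBudget`, dichotomy `WindowBarrier` (stmt-PneNP-2145) / `NoHiddenOrder` (stmt-PneNP-14781);
continuation of `…WindowCanoniserLevelsMain.lean`.

* `WCan.wDAG out` — the window canoniser as a `GateDAG` on `WCan.Node K r n` over the `(r+n) × (r+n)` input matrix,
  with output wire `out` (acyclicity: `Node.level_lt_of_args`); all gate functions in `tcBasis` and symmetric.
* `WCan.outW a b` — the output wire carrying entry `(a, b)` of the canonical form: outside–outside entries are the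
  symmetrised input bits (`Atom.oo`), the other entries are the output gates `Atom.outv` — value bits of the ROOT
  group `(univ, ∅, 0)` (adjacency of two positions, or of a position and an outside index).
* `WCan.CF K x` — THE CANONICAL FORM: entry `(a, b)` is what `wDAG (outW a b)` computes on `x`.  By construction every
  entry has the compiled circuit `(wDAG (outW a b)).compile` (`HasSymCircuit` in `…Assembly.lean`, once symmetry and
  size are established); that its graph is the graph of a `Bud`-relabelling of `x` is the content of the semantic
  files.
* `WCan.extPerm π` — the permutation of `Fin (r+n)` that is the identity on the first `r` indices and `π` on the window;
  these are exactly the members of `pointStabiliserBudget (r+n) n` (`mem_budget_iff_exists_extPerm`).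
-/

-- `Summit.PneNP.PneNP.…` duplicates `PneNP` BY DESIGN (single-problem summit, D-0017 layout).
set_option linter.dupNamespace false

noncomputable section

namespace Summit.PneNP.PneNP.Theorems

namespace WCan

open Finset Equiv Literature.Computability.Complexity

variable {K r n : ℕ}

section Dag

variable [NeZero n]

/-- **The window canoniser as a DAG** with output wire `out`. -/
def wDAG (K r n : ℕ) [NeZero n] (out : Wire K r n) : GateDAG (Fin (r + n) × Fin (r + n)) (Node K r n) where
  fn := Node.fn
  args := Node.args
  out := out
  wf := Subrelation.wf (fun ⟨_, h⟩ => Node.level_lt_of_args h) (InvImage.wf Node.level Nat.lt_wfRel.wf)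

/-- `wDAG_fn`: bookkeeping/simp lemma (wDAG fn). -/
@[simp] theorem wDAG_fn (out : Wire K r n) (l : Node K r n) : (wDAG K r n out).fn l = l.fn := rfl
/-- `wDAG_args`: bookkeeping/simp lemma (wDAG args). -/
@[simp] theorem wDAG_args (out : Wire K r n) (l : Node K r n) : (wDAG K r n out).args l = l.args := rfl
/-- `wDAG_out`: bookkeeping/simp lemma (wDAG out). -/
@[simp] theorem wDAG_out (out : Wire K r n) : (wDAG K r n out).out = out := rfl

/-- All gate functions of the DAG lie in `tcBasis`. -/
theorem wDAG_fn_mem_tcBasis (out : Wire K r n) (l : Node K r n) : (wDAG K r n out).fn l ∈ tcBasis :=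
  Node.fn_mem_tcBasis l

/-- All gate functions of the DAG are symmetric. -/
theorem wDAG_fn_isSymmetric (out : Wire K r n) (l : Node K r n) : ((wDAG K r n out).fn l).IsSymmetric :=
  Node.fn_isSymmetric l

/-- The values of the gates do not depend on the chosen output wire. -/
theorem wDAG_val (out out' : Wire K r n) : (wDAG K r n out).val = (wDAG K r n out').val := rfl

/-- **The output wire of entry `(a, b)`** (every output gate is fixed by the symmetry action). -/
def outW (K : ℕ) (a b : Fin (r + n)) : Wire K r n :=
  match finSumFinEquiv.symm a, finSumFinEquiv.symm b with
  | Sum.inl o, Sum.inl o' => if o = o' then wA Atom.ff else wA (Atom.oo o o')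
  | Sum.inl o, Sum.inr p => wA (Atom.outv (benc (.ext p o)))
  | Sum.inr p, Sum.inl o => wA (Atom.outv (benc (.ext p o)))
  | Sum.inr p, Sum.inr q => wA (Atom.outv (benc (.adj p q)))

omit [NeZero n] in
/-- Output wires are fixed by the symmetry action. -/
theorem outW_act (π : Perm (Fin n)) (a b : Fin (r + n)) :
    (outW K a b).map id (Node.act π) = outW K a b := by
  unfold outW
  rcases finSumFinEquiv.symm a with o | p <;> rcases finSumFinEquiv.symm b with o' | q <;> simp only
  · split_ifs <;> rfl
  all_goals rfl

/-- **The canonical form computed by the circuit.** -/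
def CF (K : ℕ) {r n : ℕ} [NeZero n] (x : Fin (r + n) × Fin (r + n) → Bool) : Fin (r + n) × Fin (r + n) → Bool :=
  fun ab => (wDAG K r n (outW K ab.1 ab.2)).evalOut x

/-- Entry `(a,b)` of the canonical form is computed by the compiled circuit of `wDAG (outW a b)`. -/
theorem compile_computes_CF (a b : Fin (r + n)) :
    (wDAG K r n (outW K a b)).compile.Computes fun x => CF K x (a, b) := fun x =>
  (wDAG K r n (outW K a b)).compile_eval x

/-- The compiled circuits are over `tcBasis`. -/
theorem compile_isOver (out : Wire K r n) : (wDAG K r n out).compile.IsOver tcBasis :=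
  GateDAG.compile_isOver _ (wDAG_fn_mem_tcBasis out)

/-- The compiled circuits have `|Node K r n|` gates. -/
theorem compile_size (out : Wire K r n) : (wDAG K r n out).compile.size = Fintype.card (Node K r n) := by
  rw [Circuit.size, GateDAG.compile_gates_length]

end Dag

/-! ### The window permutations as members of the budget -/

/-- The permutation of `Fin (r + n)` acting by `π` on the window and fixing the first `r` indices. -/
def extPerm (r : ℕ) {n : ℕ} (π : Perm (Fin n)) : Perm (Fin (r + n)) :=
  finSumFinEquiv.symm.trans ((Equiv.sumCongr (Equiv.refl (Fin r)) π).trans finSumFinEquiv)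

/-- `extPerm_wv`: bookkeeping/simp lemma (extPerm wv). -/
@[simp] theorem extPerm_wv (π : Perm (Fin n)) (i : Fin n) : extPerm r π (wv r i) = wv r (π i) := by
  simp [extPerm, wv]

/-- `extPerm_ov`: bookkeeping/simp lemma (extPerm ov). -/
@[simp] theorem extPerm_ov (π : Perm (Fin n)) (o : Fin r) : extPerm r π (ov n o) = ov n o := by
  simp [extPerm, ov]

/-- `extPerm` is a group homomorphism. -/
theorem extPerm_mul (π τ : Perm (Fin n)) : extPerm r (π * τ) = extPerm r π * extPerm r τ := by
  ext i
  simp only [extPerm, Perm.coe_mul, Function.comp_apply, Equiv.trans_apply]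
  rcases finSumFinEquiv.symm i with o | j <;> simp

/-- `extPerm_one`: bookkeeping/simp lemma (extPerm one). -/
@[simp] theorem extPerm_one : extPerm r (1 : Perm (Fin n)) = 1 := by
  ext i; simp [extPerm]

/-- `extPerm_inv`: bookkeeping/simp lemma (extPerm inv). -/
theorem extPerm_inv (π : Perm (Fin n)) : extPerm r π⁻¹ = (extPerm r π)⁻¹ := by
  rw [eq_inv_iff_mul_eq_one, ← extPerm_mul, inv_mul_cancel, extPerm_one]

/-- `extPerm π` fixes the first `r` indices: it lies in the budget. -/
theorem extPerm_mem_budget (π : Perm (Fin n)) : extPerm r π ∈ pointStabiliserBudget (r + n) n := by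
  intro i hi
  have : i = ov n ⟨i, by omega⟩ := Fin.ext rfl
  rw [this, extPerm_ov]

/-- Every window index is some `wv i`, every outside index some `ov o`. -/
theorem eq_wv_or_eq_ov (a : Fin (r + n)) : (∃ o, a = ov n o) ∨ ∃ i, a = wv r i := by
  rcases h : finSumFinEquiv.symm a with o | i
  · left; exact ⟨o, by simpa [ov] using (finSumFinEquiv.symm_apply_eq.1 h)⟩
  · right; exact ⟨i, by simpa [wv] using (finSumFinEquiv.symm_apply_eq.1 h)⟩

/-- **Members of the budget are exactly the window permutations** `extPerm π`. -/
theorem exists_extPerm_of_mem_budget {ρ : Perm (Fin (r + n))} (hρ : ρ ∈ pointStabiliserBudget (r + n) n) :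
    ∃ π : Perm (Fin n), ρ = extPerm r π := by
  have hov : ∀ o, ρ (ov n o) = ov n o := fun o => hρ _ (by simp [ov])
  -- `ρ` maps window indices to window indices
  have hwv : ∀ i, ∃ j, ρ (wv r i) = wv r j := by
    intro i
    rcases eq_wv_or_eq_ov (ρ (wv r i)) with ⟨o, ho⟩ | ⟨j, hj⟩
    · have : ρ (wv r i) = ρ (ov n o) := by rw [ho, hov]
      have := ρ.injective this
      simp [wv, ov, Fin.ext_iff] at this
      omega
    · exact ⟨j, hj⟩
  choose f hf using hwv
  have hfinj : Function.Injective f := by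
    intro i j hij
    have : ρ (wv r i) = ρ (wv r j) := by rw [hf, hf, hij]
    have := ρ.injective this
    simpa [wv, Fin.ext_iff] using this
  let π : Perm (Fin n) := Equiv.ofBijective f (Finite.injective_iff_bijective.1 hfinj)
  refine ⟨π, Equiv.ext fun a => ?_⟩
  rcases eq_wv_or_eq_ov a with ⟨o, rfl⟩ | ⟨i, rfl⟩
  · rw [hov, extPerm_ov]
  · rw [hf, extPerm_wv]; rfl

end WCan

end Summit.PneNP.PneNP.Theorems

end
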